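import Summits.HodgeConjecture.HodgeConjecture.Theses.CurveNetMordellWeil
import Literature.AlgebraicGeometry.HodgeTheory.MotivatedClasses
import Literature.AlgebraicGeometry.HodgeTheory.MotivatedClassesTransport
import Literature.AlgebraicGeometry.HodgeTheory.MotivatedClassesProofs
import Literature.AlgebraicGeometry.HodgeTheory.MotivatedClassesAlgebraic
import Literature.AlgebraicGeometry.HodgeTheory.HardLefschetzNFoldHolds
import Literature.AlgebraicGeometry.Motives.FamiliesVHS
import Literature.AlgebraicGeometry.Motives.SubschemeCycles
import Literature.AlgebraicGeometry.Motives.CurveNet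
import Literature.AlgebraicGeometry.HodgeTheory.IsoTransport

/-!
# Line `andre-motivated-42` — crux stmt-HodgeConjecture-2784 `CurveNetMordellWeil.VerticalSupportFourfolds`

Crux-strategist line (gen-1 re-arm after the 2026-08-17 route repair: `VerticalSupportFourfolds` is now
THE LEAD CRUX of `CurveNetMordellWeil`, a load-bearing binder of `closes`, kernel-checked equivalent to
HC(4;2,2) for all smooth projective fourfolds — `hodgeTwoTwo_le_algebraicClasses_of_verticalSupportFourfolds`
/ `verticalSupportFourfolds_of_hodgeTwoTwo`, p106042, + `CurveNetExists`). Third registered skeleton,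
beside `anchor-transport-42` (V42 ∧ An42) and `qbar-envelope-42` (E42 ∧ HCQ̄² ∧ Fulton): the
`(n, p) = (4, 2)` SLICE of ANDRÉ'S CHAIN `algebraic ⊆ motivated ⊆ Hodge` (Y. André, *Pour une théorie
inconditionnelle des motifs*, Publ. Math. IHÉS 83 (1996), §0.3, Déf. 1, Thm 0.5, Thm 0.6.2), i.e. the
summit-level route `MotivatedLefschetzSplit` (opened 2026-08-17T01:58Z, AFTER the previous strategist
pass, which deferred exactly this line "for typing reasons only": the real-carrier
`HodgeTheory.motivatedClasses` and its transport lemmas have since landed).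

It splits the PROPERTY "algebraic" of a rational `(2,2)`-class on a fourfold, not the class and not the
net (on fourfolds verticality = algebraicity, so no statement about the net can be smaller than the
crux — the diagnosis of the two dead ideation rounds):

* `stub_motivatedAnchorsFourfolds` (MA42) — MOTIVATED ANCHORS for `(2,2)`-classes on fourfolds: every
  `(X⁴, c)` sits, up to isomorphism, in a projective smooth family of fourfolds over a reduced connected
  base carrying a GLOBAL class `A` with `A|_{s₁} = c` and `A|_{s₀}` MOTIVATED at some point `s₀`.
  OPEN, the `(4,2)`-specific heart of the line. Strictly weaker than `anchor-transport-42`'s An42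
  (algebraic anchor ⇒ motivated anchor, `motivatedAnchor_of_algebraicAnchor` below) and FREE on the
  whole "dark sector" of the previous census: abelian fourfolds and abelian-motivated fourfolds
  (Thm 0.6.2/0.6.3: K3 × K3 with ANY Hodge class incl. real multiplication, K3 × abelian surface,
  cubic fourfolds, Fermat/Delsarte sextic fourfolds with their Aoki classes via Shioda–Katsura),
  CH₀-degenerate fourfolds (HC known, tree theorem). No fibrewise Hodge condition is needed (theorem
  of the fixed part).
* `stub_andreDeformation` — André's deformation theorem 0.5 (motivated-ness of a global class spreads
  from one fibre to all), verbatim the Literature NAMED FACT `Andre1996_deformation`; THEOREM-GRADE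
  debt, reduced in the tree to Mumford's curve lemma + four classical inputs
  (`MotivatedClassesDeformation*`: `Andre1996_deformation_of_published_inputs`).
* `stub_lefschetzStandardB` (B) — Grothendieck's standard conjecture of Lefschetz type, André's
  `*_L`-form, every smooth projective complex variety; verbatim the crux item
  `MotivatedLefschetzSplit.LefschetzStandardB` (stmt-HodgeConjecture-17489; staffed ONCE there) and the
  stub of line `andre-motivated-split` on stmt-14054. CONJECTURE-GRADE, not worked by this line.
* `stub_diagonalPullbackAlgebraic` (Δ) — diagonal pull-back preserves `Nᵖ H²ᵖ` (Voisin II Prop. 9.21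
  (i)); verbatim the support item `MotivatedLefschetzSplit.DiagonalPullbackAlgebraic` (stmt-17490),
  EQUIVALENT on the tree's carrier to `fulton1998_map_mem_algebraicClasses` = stub 3 of
  `qbar-envelope-42` (`Theorems.HodgeBeyondAnchors.diagonalPullbackAlgebraic_iff_fulton1998`).
  THEOREM-GRADE, L, worker-attackable, shared three ways.

Composition (sorry-free; sorries only in `stub_*`): `hodgeTwoTwoMotivated_of : MA42 → Thm 0.5 → HM42`
(every rational `(2,2)`-class on a smooth projective fourfold is MOTIVATED — the `(4,2)` instance, first
case with content, of `MotivatedLefschetzSplit.HodgeClassesMotivated`, stmt-17488), by deformation and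
iso-transport of motivated classes (`map_mem_motivatedClasses_of_iso`); then
`hodgeTwoTwo_of : MA42 → Thm 0.5 → B → Δ → HC(4;2,2)` through the tree's PROVED André §2.1 remark
`motivatedClasses_le_algebraicClasses_of_standardConjectureB_of_map_diagonal`, and `VerticalSupportFourfolds_of : crux`
(the one theorem concluding the crux by name, fed with the four stubs; `le_sup_left`).
Consistency (proved below): HC(2,2)(fourfolds) ⇒ HM42 (`hodgeTwoTwoMotivated_of_hodgeTwoTwo`), so no
stub is "more false than the crux"; MA42 ⇐ an algebraic anchor in the same frame; and the BC5-style
SPECIAL CASE `motivatedAnchorsFourfolds_of_mem_algebraicClasses`: MA42 holds for every ALGEBRAIC class via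
the constant family `X ⟶ Spec ℂ` (sorry-free: the frame is inhabited, the hypotheses of Thm 0.5 are met).

Disproof used: no `Disproof.lean` exists for this crux; rationality of `c` is load-bearing (motivated
classes are absolute Hodge, hence rational-Hodge spanned; `TypeOnly` — the crux without
`IsRationalClass` — is false at the very general sextic, IdeatorFive §1), honoured by MA42's conclusion
`A|_{s₁} = c` with `A|_{s₀}` motivated (a `ℂ`-multiple of a non-rational direction is never forced).
-/

set_option linter.dupNamespace false

noncomputable section

open CategoryTheory AlgebraicGeometry MonoidalCategory CartesianMonoidalCategory
open Literature.AlgebraicGeometry Literature.AlgebraicGeometry.Motives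
  Literature.AlgebraicGeometry.HodgeTheory

namespace Summit.HodgeConjecture.HodgeConjecture.Cruxes.VerticalSupportFourfolds.AndreMotivated42

/-! ## Registered stubs -/

/-- **Stub 1 (MA42) — MOTIVATED ANCHORS for `(2,2)`-classes on fourfolds.** For `X` smooth projective
of dimension `4` over `ℂ` and a rational class `c ∈ H⁴(X(ℂ); ℂ)` of Hodge type `(2,2)` there are a
smooth projective family `f : 𝒳 ⟶ S` of fourfolds, projective in Hartshorne's sense (closed immersion
into `ℙᴺ × S` over `S`), over a reduced, connected `ℂ`-scheme of finite type `S`, complex points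
`s₁ s₀`, an isomorphism `e : X ≅ 𝒳_{s₁}` and a global class `A ∈ H⁴(𝒳(ℂ); ℂ)` with `e^*(A|_{s₁}) = c`
and `A|_{s₀} ∈ A_mot²(𝒳_{s₀})_ℂ` (André Déf. 1 on the real carriers). The hypotheses on `(f, S)` are
literally those of `Andre1996_deformation`. OPEN (sub-crux): implied by HC(2,2)(X) (constant family,
algebraic ⊆ motivated); the geography question it isolates — does every component of the `(2,2)`
Hodge locus of a family of fourfolds contain an abelian-motivated (CM, Fermat, K3-type, abelian) or
CH₀-degenerate member, or a member where the class is otherwise known motivated? — is strictly weaker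
than An42's (algebraic member). [cite: Andre1996Motifs, Thm. 0.5 (p. 8), Thm. 0.6.2–0.6.3 (p. 9)]
[cite: CattaniDeligneKaplan1995JAMS, Thm. 1.1] -/
theorem stub_motivatedAnchorsFourfolds :
    ∀ ⦃X : SchemeOver ℂ⦄, IsSmoothProjective 4 X → ∀ c : complexBetti X (2 * 2),
      IsRationalClass c → IsOfHodgeType 4 X (2 * 2) 2 2 c →
        ∃ (𝒳 S : SchemeOver ℂ) (f : 𝒳 ⟶ S) (s₁ s₀ : ComplexPoints S) (e : X ≅ fiberOver f s₁)
          (A : complexBetti 𝒳 (2 * 2)),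
          IsSmoothProjectiveFamily f 4 ∧
          (∃ (N : ℕ) (ι : 𝒳 ⟶ projectiveSpace N ℂ ⊗ S),
            IsClosedImmersion ι.left ∧ ι ≫ snd (projectiveSpace N ℂ) S = f) ∧
          IsReduced S.left ∧ ConnectedSpace S.left ∧ LocallyOfFiniteType S.hom ∧ QuasiCompact S.hom ∧
          complexBetti.map e.hom (2 * 2) (complexBetti.map (fiberι f s₁) (2 * 2) A) = c ∧
          complexBetti.map (fiberι f s₀) (2 * 2) A ∈ motivatedClasses 4 (fiberOver f s₀) 2 := by
  sorry

/-- **Stub 2 — André's deformation theorem** (André 1996, Théorème 0.5: a global section of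
`R²ᵖ f_* ℚ` over a reduced connected base that is motivated at one complex point is motivated at every
complex point), verbatim the Literature NAMED FACT `Andre1996_deformation` (global-class form on the real
carriers). THEOREM-GRADE literature debt: the tree reduces it to Mumford's curve lemma and four classical
inputs (`Andre1996_deformation_of_published_inputs`, `Andre1996_deformation_of_four_inputs`); a worker
landing it closes this stub `--supports stmt-HodgeConjecture-2784` and feeds `MotivatedLefschetzSplit`'s
two-layer plan at once. [cite: Andre1996Motifs, Thm. 0.5 (p. 8) and §5.1 (p. 25)] -/
theorem stub_andreDeformation : Andre1996_deformation := by
  sorry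

/-- **Stub 3 (B) — the standard conjecture of Lefschetz type, André's `*_L`-form, for every smooth
projective complex variety** (Grothendieck 1968 §3; André 1996 §0.2–0.3, Prop. 1.2). CONJECTURE-GRADE;
verbatim the crux item `MotivatedLefschetzSplit.LefschetzStandardB` (stmt-HodgeConjecture-17489) — staffed
once, there. Known: curves, surfaces, abelian varieties (Lieberman), flag varieties, complete
intersections, uniruled threefolds / unirational fourfolds (Arapura 2006), hyperkähler of K3^[n] type
(Charles–Markman 2013); in-tree the middle degree for all `Z`. [cite: Andre1996Motifs, §0.3 (pp. 7–8) and Prop. 1.2 (p. 11)]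
[cite: Grothendieck1968, §3 p. 196] -/
theorem stub_lefschetzStandardB :
    ∀ (d : ℕ) (Z : SchemeOver ℂ) (η : complexBetti Z 2), IsSmoothProjective d Z →
      StandardConjectureBStar d Z η := by
  sorry

/-- **Stub 4 (Δ) — pull-back along the diagonal preserves `Nᵖ H²ᵖ`** (Voisin II Prop. 9.21 (i) with
Chow's moving lemma 9.22; Fulton §19.1 purity): verbatim the support item
`MotivatedLefschetzSplit.DiagonalPullbackAlgebraic` (stmt-HodgeConjecture-17490). THEOREM-GRADE (L);
equivalent on the tree's carrier to the named facts `Voisin2003_cupProduct_algebraicClasses` and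
`fulton1998_map_mem_algebraicClasses` (the latter is stub 3 of line `qbar-envelope-42`), so ONE worker
result discharges it for three routes. [cite: VoisinHodgeII2003, §9.2.4 Prop. 9.21 (i)]
[cite: Fulton1998, §19.2 Cor. 19.2 (b)] -/
theorem stub_diagonalPullbackAlgebraic :
    ∀ ⦃d : ℕ⦄ ⦃V : SchemeOver ℂ⦄, IsSmoothProjective d V → ∀ (p : ℕ)
      ⦃c : complexBetti (V ⊗ V) (2 * p)⦄, c ∈ algebraicClasses (V ⊗ V) p →
        complexBetti.map (lift (𝟙 V) (𝟙 V)) (2 * p) c ∈ algebraicClasses V p := by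
  sorry

/-! ## Kernel-checked composition -/

/-- **HM42 from motivated anchors and deformation**: if every `(X⁴, c)` has a motivated anchor (MA42)
and motivated-ness of a global class spreads along reduced connected projective families (Thm 0.5), then
every rational `(2,2)`-class on a smooth projective complex fourfold is MOTIVATED — the `(4,2)` instance
of `MotivatedLefschetzSplit.HodgeClassesMotivated` (stmt-HodgeConjecture-17488). Proof: deform from `s₀`
to `s₁`, then transport along `e : X ≅ 𝒳_{s₁}` (`map_mem_motivatedClasses_of_iso`).
[cite: Andre1996Motifs, Thm. 0.5 (p. 8) and §2.1 Déf. 1 (p. 14)] -/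
theorem hodgeTwoTwoMotivated_of
    (hMA : ∀ ⦃X : SchemeOver ℂ⦄, IsSmoothProjective 4 X → ∀ c : complexBetti X (2 * 2),
      IsRationalClass c → IsOfHodgeType 4 X (2 * 2) 2 2 c →
        ∃ (𝒳 S : SchemeOver ℂ) (f : 𝒳 ⟶ S) (s₁ s₀ : ComplexPoints S) (e : X ≅ fiberOver f s₁)
          (A : complexBetti 𝒳 (2 * 2)),
          IsSmoothProjectiveFamily f 4 ∧
          (∃ (N : ℕ) (ι : 𝒳 ⟶ projectiveSpace N ℂ ⊗ S),
            IsClosedImmersion ι.left ∧ ι ≫ snd (projectiveSpace N ℂ) S = f) ∧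
          IsReduced S.left ∧ ConnectedSpace S.left ∧ LocallyOfFiniteType S.hom ∧ QuasiCompact S.hom ∧
          complexBetti.map e.hom (2 * 2) (complexBetti.map (fiberι f s₁) (2 * 2) A) = c ∧
          complexBetti.map (fiberι f s₀) (2 * 2) A ∈ motivatedClasses 4 (fiberOver f s₀) 2)
    (hD : Andre1996_deformation) :
    ∀ ⦃X : SchemeOver ℂ⦄, IsSmoothProjective 4 X → ∀ c : complexBetti X (2 * 2),
      IsRationalClass c → IsOfHodgeType 4 X (2 * 2) 2 2 c → c ∈ motivatedClasses 4 X 2 := by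
  intro X hX c hc hpp
  obtain ⟨𝒳, S, f, s₁, s₀, e, A, hf, hproj, hred, hconn, hft, hqc, hAc, hs₀⟩ := hMA hX c hc hpp
  have h₁ : complexBetti.map (fiberι f s₁) (2 * 2) A ∈ motivatedClasses 4 (fiberOver f s₁) 2 :=
    hD f hf hproj hred hconn hft hqc 2 A s₀ hs₀ s₁
  have h₂ := map_mem_motivatedClasses_of_iso (hf.isSmoothProjective s₁) hX e h₁
  rwa [hAc] at h₂

/-- **HC(2,2) for fourfolds from the four statements** (hypothesis form of the composition, reusable as the
glue of a route-level split): a rational `(2,2)`-class `c` on a smooth projective fourfold is motivated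
(`hodgeTwoTwoMotivated_of`: MA42 + Thm 0.5), hence algebraic under (B) + (Δ) (André's §2.1 remark on the
real carriers, the tree's PROVED `motivatedClasses_le_algebraicClasses_of_standardConjectureB_of_map_diagonal`).
The conclusion is HC(4;2,2) spelled out (not the crux constant, so that exactly one theorem of this file
concludes the crux by name, below). [cite: Andre1996Motifs, §0.3 (pp. 7–8) and §2.1 remark following Déf. 1 (p. 14)] -/
theorem hodgeTwoTwo_of
    (hMA : ∀ ⦃X : SchemeOver ℂ⦄, IsSmoothProjective 4 X → ∀ c : complexBetti X (2 * 2),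
      IsRationalClass c → IsOfHodgeType 4 X (2 * 2) 2 2 c →
        ∃ (𝒳 S : SchemeOver ℂ) (f : 𝒳 ⟶ S) (s₁ s₀ : ComplexPoints S) (e : X ≅ fiberOver f s₁)
          (A : complexBetti 𝒳 (2 * 2)),
          IsSmoothProjectiveFamily f 4 ∧
          (∃ (N : ℕ) (ι : 𝒳 ⟶ projectiveSpace N ℂ ⊗ S),
            IsClosedImmersion ι.left ∧ ι ≫ snd (projectiveSpace N ℂ) S = f) ∧
          IsReduced S.left ∧ ConnectedSpace S.left ∧ LocallyOfFiniteType S.hom ∧ QuasiCompact S.hom ∧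
          complexBetti.map e.hom (2 * 2) (complexBetti.map (fiberι f s₁) (2 * 2) A) = c ∧
          complexBetti.map (fiberι f s₀) (2 * 2) A ∈ motivatedClasses 4 (fiberOver f s₀) 2)
    (hD : Andre1996_deformation)
    (hB : ∀ (d : ℕ) (Z : SchemeOver ℂ) (η : complexBetti Z 2), IsSmoothProjective d Z →
      StandardConjectureBStar d Z η)
    (hΔ : ∀ ⦃d : ℕ⦄ ⦃V : SchemeOver ℂ⦄, IsSmoothProjective d V → ∀ (p : ℕ)
      ⦃c : complexBetti (V ⊗ V) (2 * p)⦄, c ∈ algebraicClasses (V ⊗ V) p →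
        complexBetti.map (lift (𝟙 V) (𝟙 V)) (2 * p) c ∈ algebraicClasses V p) :
    ∀ ⦃X : SchemeOver ℂ⦄, IsSmoothProjective 4 X → ∀ c : complexBetti X (2 * 2),
      IsRationalClass c → IsOfHodgeType 4 X (2 * 2) 2 2 c → c ∈ algebraicClasses X 2 :=
  fun _ hX c hc hpp ↦ (motivatedClasses_le_algebraicClasses_of_standardConjectureB_of_map_diagonal hΔ)
    hB hX 2 (hodgeTwoTwoMotivated_of hMA hD hX c hc hpp)

/-- **HC(2,2) for fourfolds gives the crux** (the trivial direction of the landed sandwich p106042,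
re-proved here to keep the import cone to the route file: algebraic classes are the first summand of
the crux's right-hand side; the net `pr` is not used — on fourfolds vertical support = algebraicity,
IdeatorFour P0). [cite: Andre1996Motifs, §0.3 (pp. 7–8)] -/
theorem verticalSupportFourfolds_of_hodgeTwoTwo'
    (h : ∀ ⦃X : SchemeOver ℂ⦄, IsSmoothProjective 4 X → ∀ c : complexBetti X (2 * 2),
      IsRationalClass c → IsOfHodgeType 4 X (2 * 2) 2 2 c → c ∈ algebraicClasses X 2) :
    ∀ ⦃X : SchemeOver ℂ⦄ (pr : X ⟶ projectiveSpace 3 ℂ), IsSmoothProjective 4 X →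
      Function.Surjective pr.left.base →
        Submodule.span ℂ {c : complexBetti X (2 * 2) | IsRationalClass c ∧ IsOfHodgeType 4 X (2 * 2) 2 2 c} ≤
          algebraicClasses X 2 ⊔ Submodule.span ℂ {c : complexBetti X (2 * 2) | IsRationalClass c ∧
            IsOfHodgeType 4 X (2 * 2) 2 2 c ∧ ∃ T : Set (projectiveSpace 3 ℂ).left, IsClosed T ∧ T ≠ Set.univ ∧
              complexBetti.restrictCompl X (pr.left.base ⁻¹' T) (2 * 2) c = 0} := by
  intro X pr hX _
  refine le_trans (Submodule.span_le.2 ?_) le_sup_left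
  rintro c ⟨hc, hpp⟩
  exact h hX c hc hpp

/-- **Composition — the line concludes the crux BY NAME from the four registered stubs** (the only
theorem of this file whose conclusion is the crux constant; sorries sit only inside the `stub_*`, this
value uses no `sorryAx` directly): MA42 + Thm 0.5 ⇒ HM42 ⇒ (B + Δ) HC(4;2,2) ⇒ crux.
[cite: Andre1996Motifs, §0.3 (pp. 7–8) and §2.1 remark following Déf. 1 (p. 14)] -/
theorem VerticalSupportFourfolds_of :
    Summit.HodgeConjecture.HodgeConjecture.Theses.CurveNetMordellWeil.VerticalSupportFourfolds :=
  verticalSupportFourfolds_of_hodgeTwoTwo' (hodgeTwoTwo_of stub_motivatedAnchorsFourfolds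
    stub_andreDeformation stub_lefschetzStandardB stub_diagonalPullbackAlgebraic)

/-! ## Consistency: no stub is more false than the crux -/

/-- **HC(2,2) for fourfolds implies HM42**: algebraic classes are motivated (André §2.1 "il est clair
que `A_mot(X)_E` contient `A(X)`", the tree's PROVED
`algebraicClasses_le_motivatedClasses_of_nonempty_hardLefschetzNFold` with the DISCHARGED hard
Lefschetz datum of `X ⊗ X`). Hence HM42 — and with the constant family MA42 — is refutable only by a
counterexample to the crux itself. [cite: Andre1996Motifs, §2.1 remark following Déf. 1 (p. 14)] -/
theorem hodgeTwoTwoMotivated_of_hodgeTwoTwo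
    (h : ∀ ⦃X : SchemeOver ℂ⦄, IsSmoothProjective 4 X → ∀ c : complexBetti X (2 * 2),
      IsRationalClass c → IsOfHodgeType 4 X (2 * 2) 2 2 c → c ∈ algebraicClasses X 2) :
    ∀ ⦃X : SchemeOver ℂ⦄, IsSmoothProjective 4 X → ∀ c : complexBetti X (2 * 2),
      IsRationalClass c → IsOfHodgeType 4 X (2 * 2) 2 2 c → c ∈ motivatedClasses 4 X 2 :=
  fun _ hX c hc hpp ↦ algebraicClasses_le_motivatedClasses_of_nonempty_hardLefschetzNFold hX
    (nonempty_hardLefschetzNFold_holds (4 + 4) _) 2 (h hX c hc hpp)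

/-- **An algebraic anchor is a motivated anchor**: in the frame of MA42, if the global class `A` is
ALGEBRAIC on the fibre `𝒳_{s₀}` (the anchor of `anchor-transport-42`'s An42) then it is motivated there
— so MA42 asks for less than An42 at the anchor, and transport (stub 2) is a theorem instead of the
variational Hodge conjecture V42. [cite: Andre1996Motifs, §2.1 remark following Déf. 1 (p. 14) and §6.3 (p. 33)] -/
theorem motivatedAnchor_of_algebraicAnchor {𝒳 S : SchemeOver ℂ} {f : 𝒳 ⟶ S}
    (hf : IsSmoothProjectiveFamily f 4) (A : complexBetti 𝒳 (2 * 2)) (s₀ : ComplexPoints S)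
    (hA : complexBetti.map (fiberι f s₀) (2 * 2) A ∈ algebraicClasses (fiberOver f s₀) 2) :
    complexBetti.map (fiberι f s₀) (2 * 2) A ∈ motivatedClasses 4 (fiberOver f s₀) 2 :=
  algebraicClasses_le_motivatedClasses_of_nonempty_hardLefschetzNFold (hf.isSmoothProjective s₀)
    (nonempty_hardLefschetzNFold_holds (4 + 4) _) 2 hA

/-- **The two conjecture-grade stubs are jointly not weaker than needed and separately not the crux**:
(B) + (Δ) alone give `A_mot²(X)_ℂ ⊆ N² H⁴(X(ℂ); ℂ)` for every smooth projective fourfold (André's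
remark), i.e. they turn HM42 into HC(2,2) and nothing more; HM42 alone is implied by HC(2,2)
(`hodgeTwoTwoMotivated_of_hodgeTwoTwo`). [cite: Andre1996Motifs, §2.1 remark following Déf. 1 (p. 14)] -/
theorem motivated_le_algebraic_fourfolds_of_B_of_diagonal
    (hB : ∀ (d : ℕ) (Z : SchemeOver ℂ) (η : complexBetti Z 2), IsSmoothProjective d Z →
      StandardConjectureBStar d Z η)
    (hΔ : ∀ ⦃d : ℕ⦄ ⦃V : SchemeOver ℂ⦄, IsSmoothProjective d V → ∀ (p : ℕ)
      ⦃c : complexBetti (V ⊗ V) (2 * p)⦄, c ∈ algebraicClasses (V ⊗ V) p →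
        complexBetti.map (lift (𝟙 V) (𝟙 V)) (2 * p) c ∈ algebraicClasses V p)
    {X : SchemeOver ℂ} (hX : IsSmoothProjective 4 X) :
    motivatedClasses 4 X 2 ≤ algebraicClasses X 2 :=
  (motivatedClasses_le_algebraicClasses_of_standardConjectureB_of_map_diagonal hΔ) hB hX 2

/-! ## Special case (BC5-style): MA42 holds for ALGEBRAIC classes — the constant family `X ⟶ Spec ℂ`

The frame of `stub_motivatedAnchorsFourfolds` is inhabited and its definitions compute (no sorry below). -/

section ConstantFamily

open CategoryTheory.Limits

variable {X : SchemeOver ℂ}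

/-- The structure map of `Spec ℂ` over `ℂ` is an isomorphism. [folklore] -/
theorem isIso_specOver_hom : IsIso (specOver ℂ ℂ).hom :=
  CurveNet.isIso_specOver_self_hom ℂ

/-- A complex point of `Spec ℂ` has an isomorphism as underlying morphism. [folklore] -/
theorem isIso_left_complexPoints_specOver (s : ComplexPoints (specOver ℂ ℂ)) : IsIso s.left := by
  haveI := isIso_specOver_hom
  haveI : IsIso (s.left ≫ (specOver ℂ ℂ).hom) := by
    rw [Over.w s]
    exact isIso_specOver_hom
  exact IsIso.of_isIso_comp_right s.left (specOver ℂ ℂ).hom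

/-- Every fibre inclusion of the constant family `X ⟶ Spec ℂ` is an isomorphism. [folklore] -/
theorem isIso_fiberι_toSpecOver (s : ComplexPoints (specOver ℂ ℂ)) :
    IsIso (fiberι (toSpecOver X) s) := by
  haveI := isIso_left_complexPoints_specOver s
  haveI : IsIso ((Over.forget _).map (fiberι (toSpecOver X) s)) := by
    change IsIso (pullback.fst (toSpecOver X).left s.left)
    infer_instance
  exact isIso_of_reflects_iso _ (Over.forget _)

/-- The constant family `X ⟶ Spec ℂ` of a smooth projective `X` is a smooth projective family.
[folklore] -/
theorem isSmoothProjectiveFamily_toSpecOver {n : ℕ} (hX : IsSmoothProjective n X) :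
    IsSmoothProjectiveFamily (toSpecOver X) n where
  smoothOfRelativeDimension := hX.smoothOfRelativeDimension
  isProper := IsSmoothProjective.isProper_holds hX
  isSmoothProjective s :=
    haveI := isIso_fiberι_toSpecOver (X := X) s
    hX.of_iso (asIso (fiberι (toSpecOver X) s)).symm

/-- The constant family is projective in Hartshorne's sense: `X ↪ ℙᴺ × Spec ℂ` over `Spec ℂ`.
[folklore] -/
theorem exists_closedImmersion_toSpecOver {n : ℕ} (hX : IsSmoothProjective n X) :
    ∃ (N : ℕ) (ι : X ⟶ projectiveSpace N ℂ ⊗ specOver ℂ ℂ),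
      IsClosedImmersion ι.left ∧ ι ≫ snd (projectiveSpace N ℂ) (specOver ℂ ℂ) = toSpecOver X := by
  obtain ⟨N, ι, hι⟩ := hX.isProjectiveOver
  refine ⟨N, lift ι (toSpecOver X), ?_, lift_snd _ _⟩
  haveI := hι
  haveI : IsSeparated (specOver ℂ ℂ).hom := by
    change IsSeparated (Spec.map _)
    infer_instance
  haveI : IsSeparated (fst (projectiveSpace N ℂ) (specOver ℂ ℂ)).left :=
    inferInstanceAs (IsSeparated (Limits.pullback.fst (projectiveSpace N ℂ).hom (specOver ℂ ℂ).hom))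
  have h : (lift ι (toSpecOver X)).left ≫ (fst (projectiveSpace N ℂ) (specOver ℂ ℂ)).left = ι.left := by
    rw [← Over.comp_left, lift_fst]
  haveI : IsClosedImmersion
      ((lift ι (toSpecOver X)).left ≫ (fst (projectiveSpace N ℂ) (specOver ℂ ℂ)).left) := by
    rw [h]
    infer_instance
  exact IsClosedImmersion.of_comp _ (fst (projectiveSpace N ℂ) (specOver ℂ ℂ)).left

/-- **MA42 for algebraic classes** (the constant-family anchor): the conclusion of
`stub_motivatedAnchorsFourfolds` holds for every ALGEBRAIC `c ∈ N² H⁴(X(ℂ); ℂ)` on a smooth projective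
fourfold, with the constant family `X ⟶ Spec ℂ`. [cite: Andre1996Motifs, §2.1 remark following Déf. 1 (p. 14)] -/
theorem motivatedAnchorsFourfolds_of_mem_algebraicClasses (hX : IsSmoothProjective 4 X)
    (c : complexBetti X (2 * 2)) (hc : c ∈ algebraicClasses X 2) :
    ∃ (𝒳 S : SchemeOver ℂ) (f : 𝒳 ⟶ S) (s₁ s₀ : ComplexPoints S) (e : X ≅ fiberOver f s₁)
      (A : complexBetti 𝒳 (2 * 2)),
      IsSmoothProjectiveFamily f 4 ∧
      (∃ (N : ℕ) (ι : 𝒳 ⟶ projectiveSpace N ℂ ⊗ S),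
        IsClosedImmersion ι.left ∧ ι ≫ snd (projectiveSpace N ℂ) S = f) ∧
      IsReduced S.left ∧ ConnectedSpace S.left ∧ LocallyOfFiniteType S.hom ∧ QuasiCompact S.hom ∧
      complexBetti.map e.hom (2 * 2) (complexBetti.map (fiberι f s₁) (2 * 2) A) = c ∧
      complexBetti.map (fiberι f s₀) (2 * 2) A ∈ motivatedClasses 4 (fiberOver f s₀) 2 := by
  have hf := isSmoothProjectiveFamily_toSpecOver hX
  let s : ComplexPoints (specOver ℂ ℂ) := 𝟙 (specOver ℂ ℂ)
  haveI := isIso_fiberι_toSpecOver (X := X) s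
  let e' : fiberOver (toSpecOver X) s ≅ X := asIso (fiberι (toSpecOver X) s)
  haveI := isIso_specOver_hom
  refine ⟨X, specOver ℂ ℂ, toSpecOver X, s, s, e'.symm, c, hf, exists_closedImmersion_toSpecOver hX,
    ?_, ?_, ?_, ?_, ?_, ?_⟩
  · change IsReduced (Spec _)
    infer_instance
  · change ConnectedSpace (Spec _)
    infer_instance
  · infer_instance
  · infer_instance
  · change complexBetti.map e'.inv (2 * 2) (complexBetti.map e'.hom (2 * 2) c) = c
    exact complexBetti.map_inv_map_hom_apply e' (2 * 2) c
  · have halg : complexBetti.map (fiberι (toSpecOver X) s) (2 * 2) c ∈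
        algebraicClasses (fiberOver (toSpecOver X) s) 2 :=
      (mem_algebraicClasses_map_iff_of_iso e').2 hc
    exact algebraicClasses_le_motivatedClasses_of_nonempty_hardLefschetzNFold (hf.isSmoothProjective s)
      (nonempty_hardLefschetzNFold_holds (4 + 4) _) 2 halg

end ConstantFamily

end Summit.HodgeConjecture.HodgeConjecture.Cruxes.VerticalSupportFourfolds.AndreMotivated42

end
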